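import Summits.RiemannHypothesis.RiemannHypothesis.Theorems.MotivicDoor.AWS.PrimeSideLattice
import Summits.RiemannHypothesis.RiemannHypothesis.Theorems.MotivicDoor.AWS.Plumbing

/-!
# Levels of the `ArithmeticWeilSurface` axiom system, I: truncation, polarisation, finite positivity

(pub-rhdoor cell, seat cc-4 = the forcing lemma; kernel form of AXIOM-CONTENT.md §2 "FINITE
LEVELS" and of carrier-1's CARRIER-DESIGN F1; continued in `AWS.LevelwiseForcing`.)

HONEST LABEL (verbatim, binding).  The sprint theorem `riemannHypothesis_of_arithmeticWeilSurface`
is a one-way implication from a strengthened, prime-side-only axiom system; the existence of such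
an object is NOT claimed and is the located gap; the converse (RH ⇒ existence) is out of scope —
and, for this axiom system, tautological rather than informative (AXIOM-CONTENT.md §2;
`riemannHypothesis_iff_exists_tautologicalCarrier`,
`nonempty_arithmeticWeilSurface_iff_riemannHypothesis`).  VERDICT (AXIOM-CONTENT.md §0,
referee-signed): `Nonempty ArithmeticWeilSurface` is a restatement of RH in structure clothing,
not a different-looking hypothesis.  FRAMING: lottery ticket at the motivic door; RH probability
negligible; consolation prizes are real: a new semi-local Weil-positivity theorem, or a located
gap in the Connes–Consani programme, plus the ff-door theorem.

## What this file proves (sorry-free; nothing here is evidence for RH)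

The realisation search was instructed to use LITERALLY the structure's finite-level truncations,
"so any realisation tower is a candidate hypothesis of a kernel-checked implication".  This file
types the truncation and computes what a level can and cannot choose.

* `GeneratingFamily.Level G s` — the LEVEL-`s` TRUNCATION of the axiom system (`s` a finite set
  of generators): the same fields, the three Frobenius data axioms being asked only of integer
  combinations supported in `s`; the Hodge-index field verbatim.  Every `ArithmeticWeilSurface`
  truncates to every level (`ArithmeticWeilSurface.level`); levels restrict (`Level.restrict`).
* `Level.inter_lift_lift` — POLARISATION: in ANY level-`s` realisation the pairings among the
  classes `D_c + a e₁ + b e₂` (`supp c ⊆ s`) are forced to equal the decreed prime-side pairing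
  `GeneratingFamily.primeInter` of the canonical carrier (`AWS.PrimeSideLattice`).  A realisation
  has no freedom on the span of `frob i (i ∈ s), e₁, e₂`.
* `Level.levelPos` — A LEVEL CERTIFIES FINITE WEIL POSITIVITY: every level-`s` realisation gives
  `G.LevelPos s := ∀ r, 0 ≤ Re Q(Σ_{i ∈ s} r_i φ_i)`, nonnegativity of the quadratic form whose
  matrix is the finite Gram matrix `(Re W(φ_i ⋆ φ̃_j))_{i,j ∈ s}` — a finite case of Weil's
  criterion, i.e. what a `weilobs`-type certificate decides.  The converse (a level certifies
  NOTHING ELSE) and the levelwise forcing `RH ↔ ∀ s, Nonempty (G.Level s)` are in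
  `AWS.LevelwiseForcing`.
-/

noncomputable section

open Complex Set MeasureTheory Literature.NumberTheory.LFunctions
open Literature.NumberTheory.ConnesConsani2019
open Summit.RiemannHypothesis.RiemannHypothesis.Theorems.MotivicDoor.ConnesConsani
open Summit.RiemannHypothesis.RiemannHypothesis.Theorems.PfPersistence
open scoped BigOperators ComplexConjugate

namespace Summit.RiemannHypothesis.RiemannHypothesis.Theorems.MotivicDoor.AWS

namespace GeneratingFamily

variable (G : GeneratingFamily)

/-! ## The level-`s` truncation of the axiom system -/

/-- **Level-`s` truncation of `ArithmeticWeilSurface`** over the generating family `G`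
(`s : Finset G.ι`): a lattice with a symmetric biadditive real pairing, a hyperbolic pair
`e₁, e₂`, classes `frob i`, the prime-side Frobenius data for every integer combination
SUPPORTED IN `s`, and the Hodge-index sign condition verbatim. -/
structure Level (s : Finset G.ι) where
  /-- The lattice of the level. -/
  L : Type
  [instAddCommGroup : AddCommGroup L]
  /-- The pairing (biadditive, real-valued). -/
  inter : L →+ L →+ ℝ
  inter_comm : ∀ x y : L, inter x y = inter y x
  /-- The two rulings. -/
  e₁ : L
  e₂ : L
  inter_e₁_e₁ : inter e₁ e₁ = 0
  inter_e₂_e₂ : inter e₂ e₂ = 0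
  inter_e₁_e₂ : inter e₁ e₂ = 1
  /-- Frobenius-type classes (only combinations supported in `s` are constrained). -/
  frob : G.ι → L
  frob_e₁ : ∀ c : G.ι →₀ ℤ, c.support ⊆ s →
    inter (c.sum fun i n ↦ n • frob i) e₁ = massDstar (toMul (testCombination G.φ c))
  frob_e₂ : ∀ c : G.ι →₀ ℤ, c.support ⊆ s →
    inter (c.sum fun i n ↦ n • frob i) e₂ = massDu (toMul (testCombination G.φ c))
  frob_frob : ∀ c : G.ι →₀ ℤ, c.support ⊆ s →
    inter (c.sum fun i n ↦ n • frob i) (c.sum fun i n ↦ n • frob i) =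
      2 * ccPairing (toMul (testCombination G.φ c)) (toMul (testCombination G.φ c))
  hodge : ∀ (n : ℕ) (v : Fin n → L) (a : Fin n → ℝ),
    (∑ k, a k * inter (v k) e₁ = 0) → (∑ k, a k * inter (v k) e₂ = 0) →
      ∑ k, ∑ l, a k * a l * inter (v k) (v l) ≤ 0

/-- The lattice of a level is an additive commutative group. -/
instance {s : Finset G.ι} (Y : G.Level s) : AddCommGroup Y.L := Y.instAddCommGroup

namespace Level

variable {G} {s t : Finset G.ι} (Y : G.Level s)

/-- **Restriction**: a level-`s` realisation is a level-`t` realisation for every `t ⊆ s`. -/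
def restrict (h : t ⊆ s) : G.Level t where
  L := Y.L
  inter := Y.inter
  inter_comm := Y.inter_comm
  e₁ := Y.e₁
  e₂ := Y.e₂
  inter_e₁_e₁ := Y.inter_e₁_e₁
  inter_e₂_e₂ := Y.inter_e₂_e₂
  inter_e₁_e₂ := Y.inter_e₁_e₂
  frob := Y.frob
  frob_e₁ c hc := Y.frob_e₁ c (hc.trans h)
  frob_e₂ c hc := Y.frob_e₂ c (hc.trans h)
  frob_frob c hc := Y.frob_frob c (hc.trans h)
  hodge := Y.hodge

/-- The cycle `D_c = Σ c_i frob i` of an integer combination. -/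
def cycle (c : G.ι →₀ ℤ) : Y.L := c.sum fun i n ↦ n • Y.frob i

/-- `D_{c + c'} = D_c + D_{c'}`. -/
theorem cycle_add (c c' : G.ι →₀ ℤ) : Y.cycle (c + c') = Y.cycle c + Y.cycle c' := by
  simp only [cycle]
  exact Finsupp.sum_add_index' (fun i ↦ zero_zsmul (Y.frob i)) fun i m n ↦ add_zsmul (Y.frob i) m n

/-- `D_0 = 0`. -/
theorem cycle_zero : Y.cycle 0 = 0 := Finsupp.sum_zero_index

/-- `D_{n δ_i} = n • frob i`. -/
theorem cycle_single (i : G.ι) (n : ℤ) : Y.cycle (Finsupp.single i n) = n • Y.frob i := by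
  simp only [cycle]
  exact Finsupp.sum_single_index (zero_zsmul _)

/-- Additivity of the pairing in the first slot. -/
theorem inter_add_left (u v w : Y.L) : Y.inter (u + v) w = Y.inter u w + Y.inter v w := by
  rw [map_add, AddMonoidHom.add_apply]

/-- Additivity of the pairing in the second slot. -/
theorem inter_add_right (u v w : Y.L) : Y.inter u (v + w) = Y.inter u v + Y.inter u w :=
  map_add _ _ _

/-- Integer scalars in the second slot. -/
theorem inter_zsmul_right (u : Y.L) (n : ℤ) (w : Y.L) :
    Y.inter u (n • w) = n * Y.inter u w := by
  rw [map_zsmul, zsmul_eq_mul]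

/-- Integer scalars in the first slot. -/
theorem inter_zsmul_left (n : ℤ) (u w : Y.L) : Y.inter (n • u) w = n * Y.inter u w := by
  rw [Y.inter_comm, inter_zsmul_right, Y.inter_comm]

/-- `e₂·e₁ = 1`. -/
theorem inter_e₂_e₁ : Y.inter Y.e₂ Y.e₁ = 1 := by rw [Y.inter_comm]; exact Y.inter_e₁_e₂

variable {c c' : G.ι →₀ ℤ}

/-- Degree datum at the level: `D_c·e₁ = d*(c)` (`supp c ⊆ s`). -/
theorem inter_cycle_e₁ (hc : c.support ⊆ s) : Y.inter (Y.cycle c) Y.e₁ = G.dstarHom c :=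
  Y.frob_e₁ c hc

/-- Degree datum at the level: `D_c·e₂ = d_u(c)` (`supp c ⊆ s`). -/
theorem inter_cycle_e₂ (hc : c.support ⊆ s) : Y.inter (Y.cycle c) Y.e₂ = G.duHom c :=
  Y.frob_e₂ c hc

/-- `e₁·D_c = d*(c)`. -/
theorem inter_e₁_cycle (hc : c.support ⊆ s) : Y.inter Y.e₁ (Y.cycle c) = G.dstarHom c := by
  rw [Y.inter_comm]; exact Y.inter_cycle_e₁ hc

/-- `e₂·D_c = d_u(c)`. -/
theorem inter_e₂_cycle (hc : c.support ⊆ s) : Y.inter Y.e₂ (Y.cycle c) = G.duHom c := by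
  rw [Y.inter_comm]; exact Y.inter_cycle_e₂ hc

/-- Self-intersection at the level, through the PROVED identity `2𝔰(f,f) = 2 d*(f) d_u(f) − Re Q(u)`
(`two_mul_ccPairing_sub_two_mul_masses_eq`): `D_c·D_c = 2 d*(c) d_u(c) − Re Q(g_c)`. -/
theorem inter_cycle_self (hc : c.support ⊆ s) :
    Y.inter (Y.cycle c) (Y.cycle c) = 2 * (G.dstarHom c * G.duHom c) - G.crossRe c c := by
  have h : 2 * ccPairing (toMul (testCombination G.φ c)) (toMul (testCombination G.φ c)) -
      2 * (massDstar (toMul (testCombination G.φ c)) * massDu (toMul (testCombination G.φ c))) =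
        -(weilQuadratic (G.ctest c)).re :=
    two_mul_ccPairing_sub_two_mul_masses_eq (G.isWeilTest_ctest c)
  have hf : Y.inter (Y.cycle c) (Y.cycle c) =
      2 * ccPairing (toMul (testCombination G.φ c)) (toMul (testCombination G.φ c)) :=
    Y.frob_frob c hc
  rw [hf, crossRe_self, dstarHom_apply, duHom_apply]
  linarith

/-- **Polarisation**: every pairing among Frobenius cycles of level `s` is forced by the data:
`D_c·D_{c'} = d*(c) d_u(c') + d*(c') d_u(c) − Re W(g_c ⋆ g̃_{c'})`. -/
theorem inter_cycle_cycle (hc : c.support ⊆ s) (hc' : c'.support ⊆ s) :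
    Y.inter (Y.cycle c) (Y.cycle c') =
      G.dstarHom c * G.duHom c' + G.dstarHom c' * G.duHom c - G.crossRe c c' := by
  classical
  have hcc' : (c + c').support ⊆ s := Finsupp.support_add.trans (Finset.union_subset hc hc')
  have h := Y.inter_cycle_self hcc'
  rw [cycle_add, inter_add_left, inter_add_right, inter_add_right, map_add, map_add,
    crossRe_add_left, crossRe_add_right, crossRe_add_right, Y.inter_comm (Y.cycle c') (Y.cycle c),
    G.crossRe_comm c' c] at h
  have h₁ := Y.inter_cycle_self hc
  have h₂ := Y.inter_cycle_self hc'
  linear_combination (h - h₁ - h₂) / 2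

/-- The class `D_c + a e₁ + b e₂` of a vector `(c, a, b)` of the canonical prime-side lattice. -/
def lift (x : G.PrimeLattice) : Y.L := Y.cycle x.1 + x.2.1 • Y.e₁ + x.2.2 • Y.e₂

/-- `lift e₁ = e₁`. -/
theorem lift_primeE₁ : Y.lift G.primeE₁ = Y.e₁ := by simp [lift, primeE₁, cycle_zero]

/-- `lift e₂ = e₂`. -/
theorem lift_primeE₂ : Y.lift G.primeE₂ = Y.e₂ := by simp [lift, primeE₂, cycle_zero]

/-- `lift (frob i) = frob i`. -/
theorem lift_primeFrob (i : G.ι) : Y.lift (G.primeFrob i) = Y.frob i := by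
  simp [lift, primeFrob, cycle_single]

/-- **A level realisation is isometric to the canonical carrier on its level-`s` classes**: every
pairing among the classes `D_c + a e₁ + b e₂` (`supp c ⊆ s`) equals the decreed prime-side pairing
`primeInter` — the realisation has no freedom on the span of `frob i (i ∈ s), e₁, e₂`. -/
theorem inter_lift_lift (x y : G.PrimeLattice) (hx : x.1.support ⊆ s) (hy : y.1.support ⊆ s) :
    Y.inter (Y.lift x) (Y.lift y) = G.primeInter x y := by
  simp only [lift, inter_add_left, inter_add_right, inter_zsmul_left, inter_zsmul_right,
    Y.inter_cycle_cycle hx hy, Y.inter_cycle_e₁ hx, Y.inter_cycle_e₂ hx, Y.inter_e₁_cycle hy,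
    Y.inter_e₂_cycle hy, Y.inter_e₁_e₁, Y.inter_e₂_e₂, Y.inter_e₁_e₂, Y.inter_e₂_e₁,
    primeInter_apply, interFun, crossHom_apply]
  ring

/-- `lift x · e₁ = x · e₁` (prime side). -/
theorem inter_lift_e₁ (x : G.PrimeLattice) (hx : x.1.support ⊆ s) :
    Y.inter (Y.lift x) Y.e₁ = G.primeInter x G.primeE₁ := by
  rw [← Y.lift_primeE₁]
  exact Y.inter_lift_lift x G.primeE₁ hx (by simp [primeE₁])

/-- `lift x · e₂ = x · e₂` (prime side). -/
theorem inter_lift_e₂ (x : G.PrimeLattice) (hx : x.1.support ⊆ s) :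
    Y.inter (Y.lift x) Y.e₂ = G.primeInter x G.primeE₂ := by
  rw [← Y.lift_primeE₂]
  exact Y.inter_lift_lift x G.primeE₂ hx (by simp [primeE₂])

end Level

/-! ## Finite Weil positivity at level `s` -/

/-- **Finite Weil positivity at level `s`**: `Re Q(Σ_{i ∈ s} r_i φ_i) ≥ 0` for all real
coefficients (the quadratic form of the finite Gram matrix `(Re W(φ_i ⋆ φ̃_j))_{i,j ∈ s}`;
a finite case of Weil's criterion). -/
def LevelPos (s : Finset G.ι) : Prop :=
  ∀ r : G.ι → ℝ, 0 ≤ (weilQuadratic fun t ↦ ∑ i ∈ s, (r i : ℂ) * (G.φ i t : ℂ)).re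

/-- `g_{δ_i} = φ_i`. -/
theorem ctest_single (i : G.ι) : G.ctest (Finsupp.single i 1) = fun t ↦ (G.φ i t : ℂ) := by
  funext t
  simp [ctest, testCombination, Finsupp.sum_single_index]

/-- `g_0 = 0`. -/
theorem ctest_zero : G.ctest 0 = 0 := by
  funext t
  simp [ctest, testCombination]

/-- A real combination of integer combinations supported in `s` is a real combination of the
generators in `s`: `Σ_k a_k g_{c_k} = Σ_{i ∈ s} (Σ_k a_k c_k(i)) φ_i`. -/
theorem sum_ctest_eq_sum_generators {s : Finset G.ι} {κ : Type*} [Fintype κ]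
    (c : κ → (G.ι →₀ ℤ)) (hc : ∀ k, (c k).support ⊆ s) (a : κ → ℝ) (t : ℝ) :
    ∑ k, (a k : ℂ) * G.ctest (c k) t =
      ∑ i ∈ s, ((∑ k, a k * (c k i : ℝ) : ℝ) : ℂ) * (G.φ i t : ℂ) := by
  have h : ∀ k, G.ctest (c k) t = ∑ i ∈ s, ((c k i : ℤ) : ℂ) * (G.φ i t : ℂ) := by
    intro k
    simp only [ctest, testCombination]
    rw [Finsupp.sum_of_support_subset (c k) (hc k) (fun i n ↦ (n : ℝ) * G.φ i t)
      (fun i _ ↦ by simp)]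
    push_cast
    rfl
  simp_rw [h, Finset.mul_sum]
  rw [Finset.sum_comm]
  refine Finset.sum_congr rfl fun i _ ↦ ?_
  rw [Complex.ofReal_sum, Finset.sum_mul]
  refine Finset.sum_congr rfl fun k _ ↦ ?_
  push_cast
  ring

variable {G} in
/-- Finite positivity at level `s` controls every real combination of the `g_c`, `supp c ⊆ s`. -/
theorem LevelPos.sum_ctest_nonneg {s : Finset G.ι} (h : G.LevelPos s) {κ : Type*} [Fintype κ]
    (c : κ → (G.ι →₀ ℤ)) (hc : ∀ k, (c k).support ⊆ s) (a : κ → ℝ) :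
    0 ≤ (weilQuadratic fun t ↦ ∑ k, (a k : ℂ) * G.ctest (c k) t).re := by
  have hfun : (fun t ↦ ∑ k, (a k : ℂ) * G.ctest (c k) t) =
      fun t ↦ ∑ i ∈ s, ((∑ k, a k * (c k i : ℝ) : ℝ) : ℂ) * (G.φ i t : ℂ) :=
    funext fun t ↦ G.sum_ctest_eq_sum_generators c hc a t
  rw [hfun]
  exact h fun i ↦ ∑ k, a k * (c k i : ℝ)

/-- `sum_sum_primeInter` (the Hodge form of the canonical carrier is `2(Σ·e₁)(Σ·e₂) − Re Q`) for
an arbitrary finite index type. -/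
theorem sum_sum_primeInter_fintype {κ : Type*} [Fintype κ] (v : κ → G.PrimeLattice)
    (a : κ → ℝ) :
    ∑ k, ∑ l, a k * a l * G.primeInter (v k) (v l) =
      2 * (∑ k, a k * G.primeInter (v k) G.primeE₁) * (∑ k, a k * G.primeInter (v k) G.primeE₂)
        - (weilQuadratic fun t ↦ ∑ k, (a k : ℂ) * G.ctest (v k).1 t).re := by
  classical
  obtain ⟨n, ⟨e⟩⟩ := Finite.exists_equiv_fin κ
  have hR : ∀ f : κ → ℝ, ∑ k, f k = ∑ j : Fin n, f (e.symm j) :=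
    fun f ↦ (e.symm.sum_comp f).symm
  have hC : ∀ f : κ → ℂ, ∑ k, f k = ∑ j : Fin n, f (e.symm j) :=
    fun f ↦ (e.symm.sum_comp f).symm
  simp only [hR, hC]
  exact G.sum_sum_primeInter n (fun j ↦ v (e.symm j)) fun j ↦ a (e.symm j)

variable {G} in
/-- **A level realisation certifies finite Weil positivity at its level**: Hodge index on the
classes `frob i (i ∈ s), e₁, e₂` — which pair by the decreed form (`Level.inter_lift_lift`), whose
Hodge form is `−Re Q` on `⟨e₁, e₂⟩^⊥` (`sum_sum_primeInter`). -/
theorem Level.levelPos {s : Finset G.ι} (Y : G.Level s) : G.LevelPos s := by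
  classical
  intro r
  obtain ⟨A, hA⟩ : ∃ A : ℝ, A = ∑ i : s, r i * G.dstarHom (Finsupp.single (i : G.ι) 1) :=
    ⟨_, rfl⟩
  obtain ⟨B, hB⟩ : ∃ B : ℝ, B = ∑ i : s, r i * G.duHom (Finsupp.single (i : G.ι) 1) := ⟨_, rfl⟩
  -- prime-side vectors (the generators in `s`, then `e₁`, `e₂`) and coefficients `(r, −B, −A)`
  let x : s ⊕ Fin 2 → G.PrimeLattice := Sum.elim (fun i ↦ G.primeFrob i) ![G.primeE₁, G.primeE₂]
  let a : s ⊕ Fin 2 → ℝ := Sum.elim (fun i ↦ r i) ![-B, -A]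
  have xl : ∀ i : s, x (Sum.inl i) = G.primeFrob i := fun _ ↦ rfl
  have x0 : x (Sum.inr 0) = G.primeE₁ := rfl
  have x1 : x (Sum.inr 1) = G.primeE₂ := rfl
  have al : ∀ i : s, a (Sum.inl i) = r i := fun _ ↦ rfl
  have a0 : a (Sum.inr 0) = -B := rfl
  have a1 : a (Sum.inr 1) = -A := rfl
  have hx : ∀ k, (x k).1.support ⊆ s := by
    rintro (i | j)
    · show (Finsupp.single (i : G.ι) (1 : ℤ)).support ⊆ s
      exact fun l hl ↦ by rw [Finset.mem_singleton.1 (Finsupp.support_single_subset hl)]; exact i.2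
    · revert j
      rw [Fin.forall_fin_two, x0, x1]
      exact ⟨by simp [primeE₁], by simp [primeE₂]⟩
  -- the `⊥` conditions, evaluated on the prime side
  have h₁' : ∑ k, a k * G.primeInter (x k) G.primeE₁ = 0 := by
    rw [Fintype.sum_sum_type, Fin.sum_univ_two, x0, x1, a0, a1]
    simp only [xl, al, primeInter_e₁_right]
    simp only [primeFrob, primeE₁, primeE₂, map_zero, Int.cast_zero, Int.cast_one, add_zero,
      zero_add, mul_zero, mul_one, ← hA]
    ring
  have h₂' : ∑ k, a k * G.primeInter (x k) G.primeE₂ = 0 := by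
    rw [Fintype.sum_sum_type, Fin.sum_univ_two, x0, x1, a0, a1]
    simp only [xl, al, primeInter_e₂_right]
    simp only [primeFrob, primeE₁, primeE₂, map_zero, Int.cast_zero, Int.cast_one, add_zero,
      zero_add, mul_zero, mul_one, ← hB]
    ring
  -- the same conditions and the Hodge form on `Y`, transported by the isometry `inter_lift_lift`
  have h₁ : ∑ k, a k * Y.inter (Y.lift (x k)) Y.e₁ = 0 := by
    rw [← h₁']
    exact Finset.sum_congr rfl fun k _ ↦ by rw [Y.inter_lift_e₁ _ (hx k)]
  have h₂ : ∑ k, a k * Y.inter (Y.lift (x k)) Y.e₂ = 0 := by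
    rw [← h₂']
    exact Finset.sum_congr rfl fun k _ ↦ by rw [Y.inter_lift_e₂ _ (hx k)]
  have hH : ∑ k, ∑ l, a k * a l * Y.inter (Y.lift (x k)) (Y.lift (x l)) ≤ 0 :=
    (show IsHodgeNonpos Y.inter Y.e₁ Y.e₂ from Y.hodge).fintype (fun k ↦ Y.lift (x k)) a h₁ h₂
  have hsum : ∑ k, ∑ l, a k * a l * Y.inter (Y.lift (x k)) (Y.lift (x l)) =
      ∑ k, ∑ l, a k * a l * G.primeInter (x k) (x l) :=
    Finset.sum_congr rfl fun k _ ↦ Finset.sum_congr rfl fun l _ ↦ by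
      rw [Y.inter_lift_lift _ _ (hx k) (hx l)]
  have hfun : (fun t ↦ ∑ k, (a k : ℂ) * G.ctest (x k).1 t) =
      fun t ↦ ∑ i ∈ s, (r i : ℂ) * (G.φ i t : ℂ) := by
    funext t
    rw [Fintype.sum_sum_type, Fin.sum_univ_two, x0, x1, a0, a1]
    simp only [xl, al, primeFrob, primeE₁, primeE₂, ctest_zero, Pi.zero_apply, mul_zero, add_zero,
      ctest_single]
    exact Finset.sum_coe_sort s (fun i ↦ (r i : ℂ) * (G.φ i t : ℂ))
  rw [hsum, G.sum_sum_primeInter_fintype, h₁', h₂', hfun] at hH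
  linarith

end GeneratingFamily

end Summit.RiemannHypothesis.RiemannHypothesis.Theorems.MotivicDoor.AWS
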